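import Summits.QuantumAdvantage.QuantumAdvantage.Theorems.LinnikCubicClassGroupsDegreeOnePrimesEscapeRayClassDHInputs
import Summits.QuantumAdvantage.QuantumAdvantage.Theorems.LinnikCubicClassGroupsDegreeOnePrimesEscapeRayClassDHPrelims
import Summits.QuantumAdvantage.QuantumAdvantage.Theorems.LinnikCubicClassGroupsDegreeOnePrimesEscapeRayClassSmoothed
import Literature.NumberTheory.LFunctions.RayClassDeuringHeilbronn
import Literature.NumberTheory.LFunctions.UniformClassGroupPNTReduction
import HarnessLib

/-!
# Linnik's theorem for cosets of a congruence class group, IV: the smoothed coset sums with the exceptional zero and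
# the Deuring–Heilbronn phenomenon

Topic `Summits/QuantumAdvantage/QuantumAdvantage/Theorems`, cell B2b-1 (linnik-cubic), PART A (gen 22); helper toward the
crux `DegreeOnePrimesEscape` (stmt-QuantumAdvantage-11543), route `LinnikCubicClassGroups`; ray-class twin of
`…ClassPNTDHSmoothed`.  HONEST FRAMING: the value of this file is a THEOREM (kernel-checked, GRH-free) — NOT summit progress.
`smoothedFiberSum_dichotomy_dh`: for `K` of degree `n > 1`, an abelian Frobenius datum `f` killing the narrow ray `mod 𝔪`,
a size parameter `Q ≥ Q_𝔪` with `|G| ≤ Q⁴`, the log-free density of the family in `Q`-form and an effective repulsion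
`c₁ Q^{−2} ≤ 1 − β₁` of the real zeros of the real members (hypothesis): EITHER `‖|G| ψ̃_τ(g_x) − F(−1)‖ ≤ η x` for
`x ≥ Q^{a₁}`, OR a real `ψ₁` has a real zero `β₁ ∈ (1 − c/(log(|d_K|N𝔪)+log 4), 1)` of `F_{ψ₁}` and
`‖|G| ψ̃_τ(g_x) − F(−1) + ψ₁(τ)⁻¹ F(−β₁)‖ ≤ η x · min(1, (1 − β₁) log x)`.  Inputs PROVED in the tree: ZFR + Landau–Page
(`exists_exceptionalZero_congruence_const`), Deuring–Heilbronn (`deuringHeilbronn_congruence`).  [Weiss1983, Thm 5.2]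
-/

noncomputable section

open Complex Real Set Filter Topology NumberField IsDedekindDomain
open scoped NumberField nonZeroDivisors

namespace Summit.QuantumAdvantage.QuantumAdvantage.Theorems.DegreeOnePrimesEscape

open Literature.NumberTheory.LFunctions Literature.NumberTheory.LFunctions.NumberField
  Literature.NumberTheory.LFunctions.EntireEF Literature.NumberTheory.LFunctions.TZWeight
  Literature.NumberTheory.LFunctions.AbelianDensity
open scoped Classical

set_option maxHeartbeats 4000000 in
/-- **The smoothed coset sums of a congruence class group `mod 𝔪`, two-sided, with the exceptional zero of the
family and the Deuring–Heilbronn phenomenon** (see the module docstring).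
[cite: Weiss1983, Theorem 5.2] [cite: ThornerZaman2017, Theorem 3.1] [cite: ThornerZaman2019, Theorem 1.4] -/
theorem smoothedFiberSum_dichotomy_dh (n : ℕ) (hn : 1 < n) {b D a : ℝ} (hb : 0 < b) (hD : 0 < D)
    (ha : 1 ≤ a) {η : ℝ} (hη : 0 < η) {c₁ : ℝ} (hc₁ : 0 < c₁) (hc₁1 : c₁ ≤ 1) :
    ∃ ν a₁ c : ℝ, 0 < ν ∧ ν ≤ 1 / 64 ∧ 1 ≤ a₁ ∧ 0 < c ∧ c ≤ 1 / (8 * ((n : ℝ) ^ 2 + 1)) ∧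
    ∀ (K : Type) [Field K] [NumberField K], Module.finrank ℚ K = n →
    ∀ (G : Type) [CommGroup G] [Finite G] (𝔪 : Ideal (𝓞 K)) (f : HeightOneSpectrum (𝓞 K) → G)
      (h𝔪 : 𝔪 ≠ ⊥) (hray : ArtinKillsRay 𝔪 f)
      (hsep : ∀ χ : AddChar (Additive G) ℂ, χ ≠ 0 →
        ∃ v : HeightOneSpectrum (𝓞 K), ¬ 𝔪 ≤ v.asIdeal ∧ χ (Additive.ofMul (f v)) ≠ 1) (Q : ℝ),
      rayCondQ K 𝔪 ≤ Q → (Nat.card G : ℝ) ≤ Q ^ (4 : ℕ) →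
      (∀ (T : ℝ), 1 ≤ T → ∀ u : AddChar (Additive G) ℂ → Finset ℂ,
        (∀ ψ, ∀ ρ ∈ u ψ, rayFamF h𝔪 hray hsep ψ ρ = 0 ∧ 1 / 4 ≤ ρ.re ∧ ρ.re < 1 ∧ |ρ.im| ≤ T) →
        ∀ α : ℝ, α ≤ 1 →
          ∑ ψ, ∑ ρ ∈ u ψ with α ≤ ρ.re, (analyticOrderNatAt (rayFamF h𝔪 hray hsep ψ) ρ : ℝ) ≤
            D * Real.exp (b * (a * Real.log Q + Real.log (T + 4))) ^ (1 - α)) →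
      (∀ ψ₁ : AddChar (Additive G) ℂ, ψ₁ + ψ₁ = 0 → ∀ β₁ : ℝ, β₁ < 1 →
        rayFamF h𝔪 hray hsep ψ₁ β₁ = 0 → c₁ * Q ^ (-(2 : ℝ)) ≤ 1 - β₁) →
      (∀ x : ℝ, Q ^ a₁ ≤ x → ∀ τ : G,
          ‖(Nat.card G : ℂ) * (smoothedPsiFiber 𝔪 f τ (tzTest (Real.log x) (x ^ (-ν))) : ℂ) -
            fordLaplace (tzTest (Real.log x) (x ^ (-ν))) (-1)‖ ≤ η * x) ∨
      ∃ (ψ₁ : AddChar (Additive G) ℂ) (β₁ : ℝ), rayFamF h𝔪 hray hsep ψ₁ β₁ = 0 ∧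
          1 - c / (Real.log (((discr K).natAbs : ℝ) * ((Ideal.absNorm 𝔪 : ℕ) : ℝ)) + Real.log 4) < β₁ ∧ β₁ < 1 ∧
          ψ₁ + ψ₁ = 0 ∧
          ∀ x : ℝ, Q ^ a₁ ≤ x → ∀ τ : G,
            ‖(Nat.card G : ℂ) * (smoothedPsiFiber 𝔪 f τ (tzTest (Real.log x) (x ^ (-ν))) : ℂ) -
              fordLaplace (tzTest (Real.log x) (x ^ (-ν))) (-1) +
              (ψ₁ (Additive.ofMul τ))⁻¹ * fordLaplace (tzTest (Real.log x) (x ^ (-ν))) (-(β₁ : ℂ))‖ ≤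
            η * x * min 1 ((1 - β₁) * Real.log x) := by
  obtain ⟨ν, a₀, A₀, hν0, hν64, ha₀1, hA₀, hZ⟩ := rayFam_zeroSum_le_zfr_of_le n hn hb hD ha
  obtain ⟨c₀, hc₀, hpack⟩ := exists_exceptionalZero_congruence_const n
  obtain ⟨Al, hAl0, hAl⟩ := exists_norm_logDeriv_classGroupLFunction_left_le
  obtain ⟨Cr, hCr0, hCr⟩ := exists_norm_logDeriv_continuation_left_le
  obtain ⟨M, hM1, hM⟩ := TZWeight.exists_smoothTransition_deriv_bound
  have hlC := leftLineConst_nonneg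
  obtain ⟨C, hC, hDH'⟩ := deuringHeilbronn_congruence
  obtain ⟨hn2, hn0⟩ : (2 : ℝ) ≤ n ∧ (0 : ℝ) < n := ⟨by exact_mod_cast hn, by exact_mod_cast (by omega : 0 < n)⟩
  set c : ℝ := min c₀ (1 / (8 * ((n : ℝ) ^ 2 + 1))) with hcdef
  have hc : 0 < c := lt_min hc₀ (by positivity)
  have hcc₀ : c ≤ c₀ := min_le_left _ _
  have hcn : c ≤ 1 / (8 * ((n : ℝ) ^ 2 + 1)) := min_le_right _ _
  set CJ : ℝ := 8 * leftLineConst * (Al + Cr) * ((n : ℝ) + 1) * M with hCJ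
  have hM0 : 0 ≤ M := by linarith
  have hCJ0 : 0 ≤ CJ := by positivity
  set cu : ℝ := min 1 (min (1 / (6 * C * n)) (η / (32 * A₀ * C ^ 2 * n ^ 2))) with hcu
  have hcu0 : 0 < cu := lt_min one_pos (lt_min (by positivity) (by positivity))
  have hcu1 : cu ≤ 1 := min_le_left _ _
  have hcuC : cu ≤ 1 / (6 * C * n) := (min_le_right _ _).trans (min_le_left _ _)
  have hcuA : cu ≤ η / (32 * A₀ * C ^ 2 * n ^ 2) := (min_le_right _ _).trans (min_le_right _ _)
  set Λ : ℝ := max 1 (Real.log (8 * A₀ / (η * cu))) with hΛ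
  have hΛ0 : 0 ≤ Λ := le_trans zero_le_one (le_max_left _ _)
  set ΛJ : ℝ := (2 + max 0 (Real.log (4 * (A₀ + 1176 + CJ) / (η * c₁)))) / ν with hΛJ
  set Λ₁ : ℝ := 8 * a * C * n with hΛ₁
  set Λ₂ : ℝ := 32 * C * n + 16 * C * n * max 0 (Real.log (1 / (2 * C * n * c₁))) with hΛ₂
  set Λ₃ : ℝ := 8 * (2 + max 0 (Real.log (8 * A₀ / (η * c₁)))) ^ 2 with hΛ₃
  set a₁ : ℝ := max (max (max a₀ 64) (max (4 * a * Λ / c) (2 * Λ ^ 2 / c)))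
    (max (max ΛJ Λ₁) (max Λ₂ Λ₃)) with ha₁
  have ha₁a₀ : a₀ ≤ a₁ := le_trans (le_trans (le_max_left _ _) (le_max_left _ _)) (le_max_left _ _)
  have ha₁64 : (64 : ℝ) ≤ a₁ := le_trans (le_trans (le_max_right _ _) (le_max_left _ _)) (le_max_left _ _)
  have ha₁32 : (32 : ℝ) ≤ a₁ := by linarith
  have ha₁i : 4 * a * Λ / c ≤ a₁ := le_trans (le_trans (le_max_left _ _) (le_max_right _ _)) (le_max_left _ _)
  have ha₁i' : 2 * Λ ^ 2 / c ≤ a₁ := le_trans (le_trans (le_max_right _ _) (le_max_right _ _)) (le_max_left _ _)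
  have ha₁J : ΛJ ≤ a₁ := le_trans (le_trans (le_max_left _ _) (le_max_left _ _)) (le_max_right _ _)
  have ha₁1' : Λ₁ ≤ a₁ := le_trans (le_trans (le_max_right _ _) (le_max_left _ _)) (le_max_right _ _)
  have ha₁2' : Λ₂ ≤ a₁ := le_trans (le_trans (le_max_left _ _) (le_max_right _ _)) (le_max_right _ _)
  have ha₁3' : Λ₃ ≤ a₁ := le_trans (le_trans (le_max_right _ _) (le_max_right _ _)) (le_max_right _ _)
  have ha₁1 : (1 : ℝ) ≤ a₁ := by linarith
  have hQa₁ : ∀ {Q x : ℝ}, 1 < Q → Q ^ a₁ ≤ x → Q ≤ x := fun hQ1 hx ↦ by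
    have := Real.rpow_le_rpow_of_exponent_le hQ1.le ha₁1; rw [Real.rpow_one] at this; exact this.trans hx
  refine ⟨ν, a₁, c, hν0, hν64, ha₁1, hc, hcn, fun K _ _ hKn G _ _ 𝔪 f h𝔪 hray hsep Q hQK hG hdens hrepul ↦ ?_⟩
  have hK : 1 < Module.finrank ℚ K := by rw [hKn]; exact hn
  obtain ⟨hQ12, -, hlogd0, -, -, -, hcondQ⟩ := raySize_facts h𝔪 hK hQK
  have hQ1 : (1 : ℝ) < Q := by linarith
  have hQ0 : (0 : ℝ) < Q := by linarith
  have hlogQ : 2 ≤ Real.log Q := two_lt_log_twelve.le.trans (Real.log_le_log (by norm_num) hQ12)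
  have hlogQ0 : 0 < Real.log Q := Real.log_pos hQ1
  have hNm : ((Ideal.absNorm 𝔪 : ℕ) : ℝ) ≤ Q := (absNorm_le_rayCondQ 𝔪).trans hQK
  have hNm1 : (1 : ℝ) ≤ ((Ideal.absNorm 𝔪 : ℕ) : ℝ) := one_le_absNorm_cast h𝔪
  have hQm2 : Q ^ (-(2 : ℝ)) ≤ 1 := Real.rpow_le_one_of_one_le_of_nonpos hQ1.le (by norm_num)
  have hQm2' : 0 < Q ^ (-(2 : ℝ)) := Real.rpow_pos_of_pos hQ0 _
  have hQexp2 : Q ^ (-(2 : ℝ)) = Real.exp (-(2 * Real.log Q)) := by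
    rw [Real.rpow_def_of_pos hQ0]; ring_nf
  have hGnn : (0 : ℝ) ≤ (Nat.card G : ℝ) := Nat.cast_nonneg _
  obtain ⟨hLPreal, hLPuniq, hLPsimple⟩ := hpack K hKn G 𝔪 f h𝔪 hray hsep
  have hpack_c₀ : ∀ (ψ : AddChar (Additive G) ℂ) (ρ : ℂ),
      (((ψ = 0 → dedekindZeta₁ K ρ = 0) ∧ (ψ ≠ 0 → datumL h𝔪 hray hsep ψ ρ = 0)) ∧
        1 - c₀ / (Real.log (((discr K).natAbs : ℝ) * ((Ideal.absNorm 𝔪 : ℕ) : ℝ)) + Real.log (|ρ.im| + 4)) < ρ.re) →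
      ρ.im = 0 ∧ ψ + ψ = 0 := fun ψ ρ h ↦ hLPreal ψ ρ h
  have hexcZ : ∀ ψ ρ, rayFamF h𝔪 hray hsep ψ ρ = 0 → rayExcRegion c K 𝔪 ρ →
      ((ψ = 0 → dedekindZeta₁ K ρ = 0) ∧ (ψ ≠ 0 → datumL h𝔪 hray hsep ψ ρ = 0)) ∧
        1 - c₀ / (Real.log (((discr K).natAbs : ℝ) * ((Ideal.absNorm 𝔪 : ℕ) : ℝ)) + Real.log (|ρ.im| + 4)) < ρ.re := by
    intro ψ ρ h0 hexc
    refine ⟨rayFamZ'_of_eq_zero h𝔪 hray hsep ψ h0, rayLpRegion_mono h𝔪 hcc₀ ?_⟩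
    obtain ⟨him, hre⟩ := hexc
    rw [him, abs_zero, zero_add]; exact hre
  have hzfr_c : ∀ (x : ℝ) (ψ : AddChar (Additive G) ℂ) (ρ : ℂ), rayFamF h𝔪 hray hsep ψ ρ = 0 →
      1 / 4 ≤ ρ.re → ρ.re < 1 → |ρ.im| ≤ x → ¬ rayExcRegion c K 𝔪 ρ →
        ρ.re ≤ 1 - c / (a * Real.log Q + Real.log (|ρ.im| + 4)) :=
    fun x ψ ρ h0 h14 h1 hx hexc ↦ rayZfr_classical h𝔪 hray hsep hK hc hcc₀ ha hQK hpack_c₀ x ψ ρ h0 h14 h1 hx hexc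
  have hcore : ∀ x : ℝ, Q ^ a₁ ≤ x → ∀ (τ : G) (Exc : AddChar (Additive G) ℂ → Finset ℂ),
      (∀ ψ, ∀ ρ ∈ Exc ψ, rayFamF h𝔪 hray hsep ψ ρ = 0 ∧ 0 < ρ.re ∧ ρ.re < 1) →
      (∀ ψ ρ, rayFamF h𝔪 hray hsep ψ ρ = 0 → 0 < ρ.re → ρ.re < 1 → rayExcRegion c K 𝔪 ρ → ρ ∈ Exc ψ) →
      ∀ cZ : ℝ, 0 < cZ →
      (∀ (ψ : AddChar (Additive G) ℂ) (ρ : ℂ), rayFamF h𝔪 hray hsep ψ ρ = 0 → 1 / 4 ≤ ρ.re →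
        ρ.re < 1 → |ρ.im| ≤ x → ¬ rayExcRegion c K 𝔪 ρ →
          ρ.re ≤ 1 - cZ / (a * Real.log Q + Real.log (|ρ.im| + 4))) →
      ‖(Nat.card G : ℂ) * (smoothedPsiFiber 𝔪 f τ (tzTest (Real.log x) (x ^ (-ν))) : ℂ) -
          fordLaplace (tzTest (Real.log x) (x ^ (-ν))) (-1) +
          ∑ ψ : AddChar (Additive G) ℂ, (ψ (Additive.ofMul τ))⁻¹ *
            ∑ ρ ∈ Exc ψ, (analyticOrderNatAt (rayFamF h𝔪 hray hsep ψ) ρ : ℂ) *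
              fordLaplace (tzTest (Real.log x) (x ^ (-ν))) (-ρ)‖ ≤
        x * (A₀ * (Real.exp (-(cZ * Real.log x / (4 * a * Real.log Q))) +
          Real.exp (-Real.sqrt (cZ * Real.log x / 4)))) + η / 4 * x * (c₁ * Q ^ (-(2 : ℝ))) := by
    intro x hx τ Exc hExc hExc' cZ hcZ hzfr
    have hxa₀ : Q ^ a₀ ≤ x := le_trans (Real.rpow_le_rpow_of_exponent_le hQ1.le ha₁a₀) hx
    have hxQ : Q ≤ x := hQa₁ hQ1 hx
    have hx1 : 1 < x := by linarith
    have hx0 : 0 < x := by linarith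
    set L : ℝ := Real.log x with hL
    have hLQ : a₁ * Real.log Q ≤ L := by
      have := Real.log_le_log (by positivity) hx
      rwa [Real.log_rpow (by linarith)] at this
    have hL2a : 2 * a₁ ≤ L := by nlinarith
    have hL64 : 64 ≤ L := by nlinarith
    have hL1 : 1 ≤ L := by linarith
    have hL0 : 0 < L := by linarith
    have hlogQL8 : Real.log Q ≤ L / 8 := by
      have : 8 * Real.log Q ≤ a₁ * Real.log Q := mul_le_mul_of_nonneg_right (by linarith) hlogQ0.le
      linarith
    have hQexp : Q ≤ Real.exp (L / 8) := le_exp_of_log_le (by linarith) hlogQL8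
    have hQexpK : ThornerZaman.condQn K ≤ Real.exp (L / 8) := hcondQ.trans hQexp
    set ε : ℝ := x ^ (-ν) with hε
    have hε0 : 0 < ε := Real.rpow_pos_of_pos hx0 _
    have hε1 : ε ≤ 1 := Real.rpow_le_one_of_one_le_of_nonpos hx1.le (by linarith)
    have hεL : ε < L / 2 := by linarith
    have hεexp : ε = Real.exp (-(ν * L)) := by
      rw [hε, Real.rpow_def_of_pos hx0, ← hL]; ring_nf
    have hBf := hZ c K hKn G 𝔪 f h𝔪 hray hsep Q hQK hG hdens x hxa₀ cZ hcZ hzfr ε le_rfl hε1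
    -- the trivial-zero terms
    have hM₀ : ∀ ψ : AddChar (Additive G) ℂ,
        (analyticOrderNatAt (rayFamF h𝔪 hray hsep ψ) 0 : ℝ) * (L + ε) ≤ 1152 * Real.exp (L / 4) := by
      intro ψ
      by_cases hψ : ψ = 0
      · subst hψ
        rw [rayFamF_zero]
        exact trivialZero_term_le_one K hK hL1 hε0.le hε1 hQexpK
      · exact rayFamMult_zero_term_le h𝔪 hray hsep hK hψ hQK hL1 hε0.le hε1 hQexp
    -- the left-line integrals
    have hW : 0 ≤ 8 * leftLineConst * ((n : ℝ) + 1) * M := by positivity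
    have hJ0 : ‖dzEFRemainder K (tzTest L ε) 0‖ ≤ CJ := by
      have hJ := leftLine_term_le_one hAl0 hAl hM K hK hL0 hε0 hεL hε1 hν64 hεexp hQexpK
      rw [hKn] at hJ
      refine hJ.trans ?_
      rw [hCJ]; nlinarith [mul_nonneg hW hCr0.le]
    have hJ : ∀ (ψ : AddChar (Additive G) ℂ) (hψ : ψ ≠ 0),
        ‖rcEFRemainder (datumData h𝔪 hray hsep ψ hψ).L (tzTest L ε) 0‖ ≤ CJ := by
      intro ψ hψ
      have hJ := rayLeftLine_term_le h𝔪 hray hsep hK hCr0 hCr hM hψ hQK hL0 hε0 hεL hε1 hν64 hεexp hQexp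
      rw [hKn] at hJ
      refine hJ.trans ?_
      rw [hCJ]; nlinarith [mul_nonneg hW hAl0.le]
    have hest := norm_card_mul_smoothedPsiFiber_sub_le h𝔪 hray hsep hx1 hε0 hε1 hεL τ Exc hExc hExc' hBf hM₀
      hJ0 hJ
    -- the imprimitive correction is absorbed: `2(L+2) log N𝔪 ≤ 24 e^{L/4}`
    have hlogNm : Real.log (Ideal.absNorm 𝔪 : ℕ) ≤ L / 8 :=
      (Real.log_le_log (by linarith) hNm).trans hlogQL8
    have himp : 2 * (L + 2) * Real.log (Ideal.absNorm 𝔪 : ℕ) ≤ 24 * Real.exp (L / 4) :=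
      imprimitive_term_le hL64 hlogNm
    have hjunk : A₀ * x ^ (1 - ν) + (Nat.card G : ℝ) * (1176 * Real.exp (L / 4) + CJ) ≤
        η / 4 * x * (c₁ * Q ^ (-(2 : ℝ))) :=
      junk_small' hA₀ hCJ0 (by norm_num) hQ12 hG hν0 hν64 hη hc₁ hx ha₁32 (by rw [← hΛJ]; exact ha₁J)
    refine hest.trans ?_
    have e : A₀ * x * (Real.exp (-(cZ * Real.log x / (4 * a * Real.log Q))) +
        Real.exp (-Real.sqrt (cZ * Real.log x / 4))) + A₀ * x ^ (1 - ν) +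
        (Nat.card G : ℝ) * (1152 * Real.exp (L / 4) + CJ + 2 * (Real.log x + 2) * Real.log (Ideal.absNorm 𝔪 : ℕ)) =
        x * (A₀ * (Real.exp (-(cZ * L / (4 * a * Real.log Q))) + Real.exp (-Real.sqrt (cZ * L / 4)))) +
        (A₀ * x ^ (1 - ν) + (Nat.card G : ℝ) * (1152 * Real.exp (L / 4) + CJ +
          2 * (L + 2) * Real.log (Ideal.absNorm 𝔪 : ℕ))) := by
      rw [hL]; ring
    rw [e]
    have hmono : (Nat.card G : ℝ) * (1152 * Real.exp (L / 4) + CJ + 2 * (L + 2) * Real.log (Ideal.absNorm 𝔪 : ℕ)) ≤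
        (Nat.card G : ℝ) * (1176 * Real.exp (L / 4) + CJ) :=
      mul_le_mul_of_nonneg_left (by linarith) hGnn
    linarith
  by_cases hex : ∃ (ψ : AddChar (Additive G) ℂ) (ρ : ℂ),
      rayFamF h𝔪 hray hsep ψ ρ = 0 ∧ 0 < ρ.re ∧ ρ.re < 1 ∧ rayExcRegion c K 𝔪 ρ
  · -- an exceptional zero `(ψ₁, ρ₁)`: real, unique, simple
    right
    obtain ⟨ψ₁, ρ₁, h0₁, hre₁, hre₁', hexc₁⟩ := hex
    have hZ₁ := hexcZ ψ₁ ρ₁ h0₁ hexc₁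
    obtain ⟨him₁, hreal₁⟩ := hLPreal _ ρ₁ hZ₁
    set β₁ : ℝ := ρ₁.re with hβ₁
    have hρ₁ : ρ₁ = (β₁ : ℂ) := by
      apply Complex.ext <;> simp [hβ₁, him₁]
    have hmult : analyticOrderNatAt (rayFamF h𝔪 hray hsep ψ₁) ρ₁ = 1 := by
      obtain ⟨hs1, hs2⟩ := hLPsimple _ ρ₁ hZ₁
      by_cases hψ : ψ₁ = 0
      · subst hψ
        have h := hs1 rfl
        have hne : analyticOrderAt (dedekindZeta₁ K) ρ₁ ≠ ⊤ := by rw [h]; exact ENat.one_ne_top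
        have : (analyticOrderNatAt (dedekindZeta₁ K) ρ₁ : ℕ∞) = 1 := by
          rw [Nat.cast_analyticOrderNatAt hne, h]
        rw [rayFamF_zero]; exact_mod_cast this
      · have h := hs2 hψ
        have hne : analyticOrderAt (datumData h𝔪 hray hsep ψ₁ hψ).L ρ₁ ≠ ⊤ := by
          rw [h]; exact ENat.one_ne_top
        have : (analyticOrderNatAt (datumData h𝔪 hray hsep ψ₁ hψ).L ρ₁ : ℕ∞) = 1 := by
          rw [Nat.cast_analyticOrderNatAt hne, h]
        rw [rayFamF_of_ne h𝔪 hray hsep hψ]; exact_mod_cast this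
    have hβ1 : β₁ < 1 := hre₁'
    have hβhalf : 1 / 2 ≤ β₁ := by
      have hlog4 : 1 < Real.log 4 := by
        rw [show (4:ℝ) = 2 ^ 2 by norm_num, Real.log_pow]; have := Real.log_two_gt_d9; push_cast; linarith
      have hc2 : c ≤ 1 / 2 :=
        hcn.trans (by rw [div_le_div_iff_of_pos_left one_pos (by positivity) (by norm_num)]; nlinarith)
      have : c / (Real.log (((discr K).natAbs : ℝ) * ((Ideal.absNorm 𝔪 : ℕ) : ℝ)) + Real.log 4) ≤ 1 / 2 := by
        rw [div_le_iff₀ (by linarith)]; nlinarith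
      linarith [hexc₁.2]
    have hβ0 : 0 < β₁ := by linarith
    have h0β : rayFamF h𝔪 hray hsep ψ₁ (β₁ : ℂ) = 0 := by rw [← hρ₁]; exact h0₁
    have hδlow : c₁ * Q ^ (-(2 : ℝ)) ≤ 1 - β₁ := hrepul ψ₁ hreal₁ β₁ hβ1 h0β
    have hexcβ : rayExcRegion c K 𝔪 (β₁ : ℂ) := by rw [← hρ₁]; exact hexc₁
    have hZβ := rayFamZ_of_eq_zero h𝔪 hray hsep ψ₁ h0β
    have hrep : ∀ (ψ : AddChar (Additive G) ℂ) (ρ : ℂ), rayFamF h𝔪 hray hsep ψ ρ = 0 → 1 / 2 ≤ ρ.re →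
        ρ ≠ 1 → ρ ≠ β₁ →
          Real.log (1 / (C * (Real.log (((discr K).natAbs : ℝ) * ((Ideal.absNorm 𝔪 : ℕ) : ℝ)) +
              Module.finrank ℚ K * (Real.log (|ρ.im| + 2) + 1)) * (1 - β₁))) /
            (C * (Real.log (((discr K).natAbs : ℝ) * ((Ideal.absNorm 𝔪 : ℕ) : ℝ)) +
              Module.finrank ℚ K * (Real.log (|ρ.im| + 2) + 1))) ≤ 1 - ρ.re :=
      fun ψ ρ h0 hge hρ1 hρβ ↦ hDH' K G 𝔪 f h𝔪 hray hsep ψ₁ hreal₁ β₁ hβ0 hβ1 hZβ ψ ρ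
        (rayFamZ_of_eq_zero h𝔪 hray hsep ψ h0) hge hρ1 hρβ
    refine ⟨ψ₁, β₁, h0β, hexc₁.2, hβ1, hreal₁, fun x hx τ ↦ ?_⟩
    set Exc : AddChar (Additive G) ℂ → Finset ℂ := fun ψ ↦ if ψ = ψ₁ then {ρ₁} else ∅ with hExcdef
    have hExc : ∀ ψ, ∀ ρ ∈ Exc ψ, rayFamF h𝔪 hray hsep ψ ρ = 0 ∧ 0 < ρ.re ∧ ρ.re < 1 := by
      intro ψ ρ hρ
      rw [hExcdef] at hρ; dsimp only at hρ
      split_ifs at hρ with hψ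
      · rw [Finset.mem_singleton] at hρ; subst hρ; subst hψ; exact ⟨h0₁, hre₁, hre₁'⟩
      · simp at hρ
    have hExc' : ∀ ψ ρ, rayFamF h𝔪 hray hsep ψ ρ = 0 → 0 < ρ.re → ρ.re < 1 → rayExcRegion c K 𝔪 ρ →
        ρ ∈ Exc ψ := by
      intro ψ ρ h0 _ _ hexc
      have hZ := hexcZ ψ ρ h0 hexc
      obtain ⟨hψ, hρρ⟩ := hLPuniq _ _ ρ ρ₁ hZ hZ₁
      rw [hExcdef]; dsimp only; rw [if_pos hψ, Finset.mem_singleton]; exact hρρ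
    have hsum : ∑ ψ : AddChar (Additive G) ℂ, (ψ (Additive.ofMul τ))⁻¹ *
        ∑ ρ ∈ Exc ψ, (analyticOrderNatAt (rayFamF h𝔪 hray hsep ψ) ρ : ℂ) *
          fordLaplace (tzTest (Real.log x) (x ^ (-ν))) (-ρ) =
        (ψ₁ (Additive.ofMul τ))⁻¹ * fordLaplace (tzTest (Real.log x) (x ^ (-ν))) (-(β₁ : ℂ)) := by
      rw [Finset.sum_eq_single ψ₁]
      · rw [hExcdef]; dsimp only; rw [if_pos rfl, Finset.sum_singleton, hmult, ← hρ₁]; push_cast; ring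
      · intro ψ _ hψ
        rw [hExcdef]; dsimp only; rw [if_neg hψ, Finset.sum_empty, mul_zero]
      · intro h; exact absurd (Finset.mem_univ _) h
    have hxQ : Q ≤ x := hQa₁ hQ1 hx
    have hx1 : 1 < x := by linarith
    have hx0 : 0 < x := by linarith
    have hLQ : a₁ * Real.log Q ≤ Real.log x := by
      have := Real.log_le_log (by positivity) hx
      rwa [Real.log_rpow (by linarith)] at this
    have hL2a : 2 * a₁ ≤ Real.log x := by nlinarith
    have hL64 : 64 ≤ Real.log x := by nlinarith
    have hL1 : 1 ≤ Real.log x := by linarith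
    have hL0 : 0 < Real.log x := by linarith
    have hδ₁0 : 0 < 1 - β₁ := by linarith
    have hη₁0 : 0 < (1 - β₁) * Real.log x := mul_pos hδ₁0 hL0
    have hδη : 1 - β₁ ≤ (1 - β₁) * Real.log x := by
      have := mul_le_mul_of_nonneg_left hL1 hδ₁0.le; rw [mul_one] at this; exact this
    have hη₁low : c₁ * Q ^ (-(2 : ℝ)) ≤ (1 - β₁) * Real.log x := hδlow.trans hδη
    have hη₁low1 : c₁ * Q ^ (-(2 : ℝ)) ≤ 1 := (mul_le_mul hc₁1 hQm2 hQm2'.le zero_le_one).trans (by norm_num)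
    have hη₁m : c₁ * Q ^ (-(2 : ℝ)) ≤ min 1 ((1 - β₁) * Real.log x) := le_min hη₁low1 hη₁low
    have hm0 : 0 ≤ min 1 ((1 - β₁) * Real.log x) := le_min zero_le_one hη₁0.le
    have hηxm : 0 ≤ η * x * min 1 ((1 - β₁) * Real.log x) := by positivity
    rcases le_or_gt cu ((1 - β₁) * Real.log x) with hA | hB
    · -- regime A: `(1 − β₁) log x ≥ cu` — the classical zero-free region suffices
      have key := hcore x hx τ Exc hExc hExc' c hc (hzfr_c x)
      rw [hsum] at key
      have hmcu : cu ≤ min 1 ((1 - β₁) * Real.log x) := le_min hcu1 hA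
      have heΛ : Real.exp (-Λ) ≤ η * cu / (8 * A₀) := by
        refine exp_neg_le_of_neg_log_le (by positivity) ?_
        rw [← Real.log_inv, inv_div]; exact le_max_right _ _
      have hzs := zeroSum_main_small (η := η * cu) hc ha hA₀ hΛ0 hlogQ0 hL0 hLQ hL2a ha₁i ha₁i' heΛ
      have h1 : x * (A₀ * (Real.exp (-(c * Real.log x / (4 * a * Real.log Q))) +
          Real.exp (-Real.sqrt (c * Real.log x / 4)))) ≤ η / 4 * x * min 1 ((1 - β₁) * Real.log x) := by
        calc x * (A₀ * (Real.exp (-(c * Real.log x / (4 * a * Real.log Q))) +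
            Real.exp (-Real.sqrt (c * Real.log x / 4))))
            ≤ x * (η * cu / 4) := mul_le_mul_of_nonneg_left hzs hx0.le
          _ = η / 4 * x * cu := by ring
          _ ≤ η / 4 * x * min 1 ((1 - β₁) * Real.log x) := mul_le_mul_of_nonneg_left hmcu (by positivity)
      have h2 : η / 4 * x * (c₁ * Q ^ (-(2 : ℝ))) ≤ η / 4 * x * min 1 ((1 - β₁) * Real.log x) :=
        mul_le_mul_of_nonneg_left hη₁m (by positivity)
      linarith [key, h1, h2, hηxm]
    · -- regime B: `(1 − β₁) log x < cu` — the Deuring–Heilbronn zero-free region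
      have hη₁1 : (1 - β₁) * Real.log x ≤ 1 := hB.le.trans hcu1
      have hmin : min 1 ((1 - β₁) * Real.log x) = (1 - β₁) * Real.log x := min_eq_right hη₁1
      have hsmall : 2 * C * n * ((1 - β₁) * Real.log x) ≤ 1 / 3 := by
        have h1 : 2 * C * n * ((1 - β₁) * Real.log x) ≤ 2 * C * n * cu :=
          mul_le_mul_of_nonneg_left hB.le (by positivity)
        have h2 : 2 * C * n * cu ≤ 2 * C * n * (1 / (6 * C * n)) :=
          mul_le_mul_of_nonneg_left hcuC (by positivity)
        have h3 : 2 * C * n * (1 / (6 * C * n)) = 1 / 3 := by field_simp; ring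
        linarith
      have hη₁A : (1 - β₁) * Real.log x ≤ η / (32 * A₀ * C ^ 2 * n ^ 2) := hB.le.trans hcuA
      have hL4 : 4 ≤ Real.log x := by linarith
      have hcZ0 : 0 < min (Real.log (1 / (2 * C * n * ((1 - β₁) * Real.log x))) / (C * n))
          (a * Real.log Q / 2) := by
        refine lt_min (div_pos (Real.log_pos ?_) (by positivity)) (by positivity)
        have h0 : 0 < 2 * C * n * ((1 - β₁) * Real.log x) := by positivity
        rw [lt_div_iff₀ h0]; linarith
      have hzfr : ∀ (ψ : AddChar (Additive G) ℂ) (ρ : ℂ), rayFamF h𝔪 hray hsep ψ ρ = 0 →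
          1 / 4 ≤ ρ.re → ρ.re < 1 → |ρ.im| ≤ x → ¬ rayExcRegion c K 𝔪 ρ →
            ρ.re ≤ 1 - min (Real.log (1 / (2 * C * n * ((1 - β₁) * Real.log x))) / (C * n))
              (a * Real.log Q / 2) / (a * Real.log Q + Real.log (|ρ.im| + 4)) :=
        ray_zfr_of_zeroRepulsion h𝔪 hray hsep hn hKn hC (c := c) (a := a) ha hQK hexcβ hβ1 hxQ hL4 hrep hsmall
      have key := hcore x hx τ Exc hExc hExc' _ hcZ0 hzfr
      rw [hsum] at key
      have hη₁low' : c₁ * Real.exp (-(2 * Real.log Q)) ≤ (1 - β₁) * Real.log x := by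
        rw [← hQexp2]; exact hη₁low
      have hlogQ1 : 1 ≤ Real.log Q := by linarith
      have hzs := dhRegime_zeroSum_small (A₀ := A₀) (C := C) (n := (n : ℝ)) (η := η)
        (η₁ := (1 - β₁) * Real.log x) (c₁ := c₁) (a := a) (lQ := Real.log Q) (L := Real.log x) (a₁ := a₁)
        hA₀ hC hn2 hη hc₁ ha hlogQ1 hη₁0 hη₁low' hsmall hη₁A hLQ
        (by rw [← hΛ₁]; exact ha₁1') (by rw [← hΛ₂]; exact ha₁2') (by rw [← hΛ₃]; exact ha₁3')
      have h1 : x * (A₀ * (Real.exp (-(min (Real.log (1 / (2 * C * n * ((1 - β₁) * Real.log x))) / (C * n))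
          (a * Real.log Q / 2) * Real.log x / (4 * a * Real.log Q))) +
          Real.exp (-Real.sqrt (min (Real.log (1 / (2 * C * n * ((1 - β₁) * Real.log x))) / (C * n))
          (a * Real.log Q / 2) * Real.log x / 4)))) ≤ η / 4 * x * ((1 - β₁) * Real.log x) := by
        calc _ ≤ x * (η / 4 * ((1 - β₁) * Real.log x)) := mul_le_mul_of_nonneg_left hzs hx0.le
          _ = η / 4 * x * ((1 - β₁) * Real.log x) := by ring
      have h2 : η / 4 * x * (c₁ * Q ^ (-(2 : ℝ))) ≤ η / 4 * x * ((1 - β₁) * Real.log x) :=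
        mul_le_mul_of_nonneg_left hη₁low (by positivity)
      rw [hmin]
      have hpos : 0 ≤ η * x * ((1 - β₁) * Real.log x) := by positivity
      linarith [key, h1, h2, hpos]
  · -- no exceptional zero
    left
    intro x hx τ
    have hx0 : 0 < x := by linarith [hQa₁ hQ1 hx]
    set L : ℝ := Real.log x with hL
    have hLQ : a₁ * Real.log Q ≤ L := by
      have := Real.log_le_log (by positivity) hx
      rwa [Real.log_rpow (by linarith)] at this
    have hL2a : 2 * a₁ ≤ L := by nlinarith
    have hL0 : 0 < L := by linarith
    have key := hcore x hx τ (fun _ ↦ ∅) (fun ψ ρ hρ ↦ by simp at hρ)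
      (fun ψ ρ h0 h1 h2 hexc ↦ absurd ⟨ψ, ρ, h0, h1, h2, hexc⟩ hex) c hc (hzfr_c x)
    simp only [Finset.sum_empty, mul_zero, Finset.sum_const_zero, add_zero] at key
    have heΛ : Real.exp (-Λ) ≤ η * cu / (8 * A₀) := by
      refine exp_neg_le_of_neg_log_le (by positivity) ?_
      rw [← Real.log_inv, inv_div]; exact le_max_right _ _
    have hzs := zeroSum_main_small (η := η * cu) hc ha hA₀ hΛ0 hlogQ0 hL0 hLQ hL2a ha₁i ha₁i' heΛ
    have h1 : x * (A₀ * (Real.exp (-(c * L / (4 * a * Real.log Q))) + Real.exp (-Real.sqrt (c * L / 4)))) ≤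
        x * (η * cu / 4) := mul_le_mul_of_nonneg_left hzs hx0.le
    have h1' : x * (η * cu / 4) ≤ x * (η * 1 / 4) := by gcongr
    have h2 : η / 4 * x * (c₁ * Q ^ (-(2 : ℝ))) ≤ η / 4 * x * 1 :=
      mul_le_mul_of_nonneg_left ((mul_le_mul hc₁1 hQm2 hQm2'.le zero_le_one).trans (by norm_num))
        (by positivity)
    have hηx : 0 < η * x := mul_pos hη hx0
    linarith

end Summit.QuantumAdvantage.QuantumAdvantage.Theorems.DegreeOnePrimesEscape

end
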